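import Summits.HodgeConjecture.HodgeConjecture.Theses.HolomorphicDefect
import Literature.AlgebraicGeometry.HodgeTheory.SupportedHodgeClassDescent
import Literature.AlgebraicGeometry.HodgeTheory.ArapuraSurfaceFibredFourfoldsProofs
import Literature.AlgebraicGeometry.HodgeTheory.GysinKernelProofs
import Literature.AlgebraicGeometry.Motives.ComplexPointsOrientation
import Literature.AlgebraicGeometry.Resolution.ProjectiveResolutionProofs
import Literature.AlgebraicTopology.SingularHomology.GysinMapSupportProofs
import Summits.HodgeConjecture.HodgeConjecture.Theorems.LimitExtensionDivisorInduction
import Literature.AlgebraicGeometry.HodgeTheory.HypersurfaceLefschetz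
import HarnessLib

/-!
# Route HolomorphicDefect · `SupportedHodgeClassDescent` (item `stmt-HodgeConjecture-3027`)

The support statement `SupportedHodgeClassDescent` of the route
`Summits/HodgeConjecture/HodgeConjecture/Theses/HolomorphicDefect`: on a smooth projective `X/ℂ` of
dimension `n`, granted the Hodge conjecture for smooth projective varieties of dimension `< n`, a
rational `(p,p)`-class supported in codimension `≥ 1` (`c ∈ N¹H²ᵖ(X(ℂ); ℂ) = supportedClasses X (2p) 1`)
is algebraic (`c ∈ algebraicClasses X p`).

This is a KNOWN theorem — Deligne, *Théorie de Hodge III*, Cor. 8.2.8, with the semisimplicity of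
polarisable Hodge structures (Voisin 2025, Cor. 2.12 / Thm. 4.4 / Cor. 4.5) and the Hodge
conjecture on the resolved components of the support — and it is proved VERBATIM in the tree's
Literature file `HodgeTheory/SupportedHodgeClassDescent` (`supportedHodgeClassDescent_of`) from
five named facts. Three of the five are THEOREMS of the tree and are discharged in this file:

* projective Hironaka — `Resolution.Hironaka1964_projective_holds` (Kollár 2007, Thm. 3.27);
* the support property of topological Gysin maps over `ℂ` —
  `gysinMap_restrictCompl_eq_zero_of_field ℂ` (Fulton, *Young Tableaux*, App. B §B.2 Ex. 5);
* an orientation family with Poincaré duality — the Literature theorem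
  `exists_orientationFamily_hasPoincareDuality` (`Motives.ComplexPoints.isOrientableOver` with
  `OrientationFamily.hasPoincareDuality`, Hatcher Thm. 3.30, proved in the tree).

What remains are the two Hodge-theoretic inputs, in neither Mathlib nor the tree, kept as
named-fact hypotheses (so the result is CONDITIONAL; trust base = these two names):

* `Deligne1974_ker_restrictCompl_eq_iSup_range_complexGysin` (Hodge III, Cor. 8.2.8: the kernel of
  `Hᵇ(X(ℂ)) → Hᵇ((X ∖ Z)(ℂ))` is the sum of the Gysin images from resolutions of the components of
  `Z`) — reduced in the tree (`HodgeTheory/GysinKernelSplit`) to the single leaf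
  `Deligne1974_ker_pullback_eq_ker_pullback_resolution` (Hodge III, Prop. 8.2.7: mixed Hodge
  theory of the singular support);
* `Voisin2025_hodgeClass_lift_complexGysin` (Voisin 2025, Cor. 2.12: Hodge classes lift along sums
  of Gysin morphisms) — reduced in the tree (`HodgeTheory/HodgeRiemannPolarizability`) to the single
  leaf `smoothProjective_hodgeStructure_isPolarizable` (Hodge–Riemann bilinear relations, Voisin I,
  Thm. 6.32).

Deliberately NOT here: the leaf-keyed variant (to be appended once the two split records are built
on the farm), and any attempt at the two leaves themselves (mixed Hodge structures on singular
varieties; Kähler identities / Hodge–Riemann), which are Literature debts, not route work.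
-/

-- `Summit.HodgeConjecture.HodgeConjecture.Theorems` is the mandated namespace (single-problem summit:
-- Problem = Summit), which `linter.dupNamespace` flags; the lakefile turns the linter off tree-wide
-- (weak option), restated here so stand-alone elaboration is warning-free too.
set_option linter.dupNamespace false

namespace Summit.HodgeConjecture.HodgeConjecture.Theorems.HolomorphicDefect

open Literature.AlgebraicGeometry Literature.AlgebraicGeometry.HodgeTheory
open Literature.AlgebraicTopology.SingularHomology

/-- **`SupportedHodgeClassDescent`, conditional on Deligne's Cor. 8.2.8 and Voisin's Cor. 2.12.**
The route statement — literally the route decl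
`Summit.HodgeConjecture.HodgeConjecture.Theses.HolomorphicDefect.SupportedHodgeClassDescent` — from
the two Hodge-theoretic named facts `Deligne1974_ker_restrictCompl_eq_iSup_range_complexGysin`
(Deligne 1974, *Hodge III*, Cor. 8.2.8) and `Voisin2025_hodgeClass_lift_complexGysin` (Voisin 2025,
Cor. 2.12), by the Literature theorem `supportedHodgeClassDescent_of`, whose other three inputs are
theorems of the tree: projective Hironaka (`Resolution.Hironaka1964_projective_holds`), the support
property of Gysin maps (`gysinMap_restrictCompl_eq_zero_of_field ℂ`) and Poincaré duality for an
orientation family (the Literature theorem `exists_orientationFamily_hasPoincareDuality`).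
Printed proof: `c` dies off a closed `Z` of codimension `≥ 1`; `Z = ⋃ⱼ gⱼ(Yⱼ)` with `Yⱼ` smooth
projective of dimension `< n` (Hironaka); `c ∈ Σⱼ im (gⱼ)_*` (Cor. 8.2.8); `c = Σⱼ (gⱼ)_* βⱼ`
with `βⱼ` rational Hodge classes (Cor. 2.12); the `βⱼ` are algebraic by the Hodge conjecture below
dimension `n`, and Gysin images of algebraic classes are algebraic. CONDITIONAL result: trust
base = the two named facts (leaves: `Deligne1974_ker_pullback_eq_ker_pullback_resolution`,
`smoothProjective_hodgeStructure_isPolarizable`). -/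
theorem supportedHodgeClassDescent_of_deligne_voisin
    (hD : Deligne1974_ker_restrictCompl_eq_iSup_range_complexGysin)
    (hV : Voisin2025_hodgeClass_lift_complexGysin) :
    Summit.HodgeConjecture.HodgeConjecture.Theses.HolomorphicDefect.SupportedHodgeClassDescent := by
  unfold Summit.HodgeConjecture.HodgeConjecture.Theses.HolomorphicDefect.SupportedHodgeClassDescent
  exact supportedHodgeClassDescent_of hD hV Resolution.Hironaka1964_projective_holds
    (gysinMap_restrictCompl_eq_zero_of_field ℂ) exists_orientationFamily_hasPoincareDuality

/-- **Item stmt-HodgeConjecture-3027 (`SupportedHodgeClassDescent`), route `HolomorphicDefect` —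
UNCONDITIONALLY**: a rational `(p, p)`-class on a smooth projective `n`-fold supported on a divisor is
algebraic, granted the Hodge conjecture for all smooth projective varieties of dimension `< n`.  For
`p = 0` and for `n = 0 < p` the algebraic classes are everything (`algebraicClasses_zero`,
`algebraicClasses_eq_top_of_lt`); otherwise `n = n' + 1`, `p ≥ 1`, and this is the tree's divisor
induction `limitExtension_divisorInduction_proof n' p` (item stmt-HodgeConjecture-1082: log resolution
of the supporting divisor, Deligne's principle of two types for snc boundaries — discharged —, Voisin's
lift along the Gysin surjection, push-forward), fed with the Hodge conjecture in codimension `p - 1` on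
the `n'`-folds.  Supersedes the conditional `supportedHodgeClassDescent_of_deligne_voisin` above.
[cite: DeligneHodgeIII1974, Prop. 8.2.7 and Cor. 8.2.8] [cite: Thomas2005Nodes, §2] -/
theorem holomorphicDefect_supportedHodgeClassDescent_proof :
    Summit.HodgeConjecture.HodgeConjecture.Theses.HolomorphicDefect.SupportedHodgeClassDescent := by
  intro n X hX hlow p c hc hpp hN
  rcases Nat.eq_zero_or_pos p with rfl | hp
  · rw [Literature.AlgebraicGeometry.HodgeTheory.algebraicClasses_zero]
    exact Submodule.mem_top
  rcases Nat.eq_zero_or_pos n with rfl | hn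
  · rw [Literature.AlgebraicGeometry.HodgeTheory.algebraicClasses_eq_top_of_lt hX hp]
    exact Submodule.mem_top
  obtain ⟨n', rfl⟩ : ∃ n', n = n' + 1 := ⟨n - 1, by omega⟩
  exact limitExtension_divisorInduction_proof n' p hp
    (fun _Y hY a ha haa ↦ (hlow (Nat.lt_succ_self n') hY).2 (p - 1) a ha haa) hX c hc hpp hN

end Summit.HodgeConjecture.HodgeConjecture.Theorems.HolomorphicDefect
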